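import Summits.QuantumFields.YangMills.Theorems.BalabanUVNodesK1R8RowsDefs
import Literature.MathematicalPhysics.QuantumFieldTheory.Balaban1983to89.Node00.Record13SepCoPHV

/-!
# Rev 28 of `route-QuantumFields-BalabanUVNodes` (director-ym №210 (δ) NULL-SET SURGERY «def-level first, route second»; plan g85 SHAPE SHEET `D85-REV28`, recipe (δⱽ)) —
# THE VERSION SLOT BY NAME: `Iff.rfl` mirrors of the three NEW ITEM TEXTS K1⁹ `StabilityBRunRowsAtRecordR13SepCoPHV` ∕ K2⁹ `EndpointGivenRunRowsR13SepCoPHV` ∕ K3⁸ `SpineGivenEndpointR13SepCoPHV`,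
# the slot faces those texts read, the doors K1⁸ ⟹ K1⁹ ∕ K2⁹ ⟹ K2⁸ ∕ K3⁸ ⟹ K3⁷, and the per-tuple use forms at the revised datum `Node00.datumOfRecord₁₃SepCoPHV F 2 θ h v`

Cell `ym-nodeO-ideate`, DEFINER seat `ym-nodeO-def-1` (gen 9).  `--kind proof --supports <K1⁹ item> --as helper`; count-neutral.  Precedent and pattern: `Thm/BalabanUVNodesK1R8RowsDefs` (rev 27, K1⁸ ∕ K2⁸
by name), `…K1V6Defs`, `…K2V6Defs` ∕ `…K2V7Defs`, `…K3V5Defs`: the texts of record as TREE NAMES with `Iff.rfl` mirrors, so that suppliers and stub proofs are filed BY NAME with one `import`.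
This file is the tree edition, BY NAME and retargeted to the ROUTE DECLS, of this seat's preview certificate `Cruxes/EndpointGivenBR13SepCoPH/DEF_1_K19VersionSlotSketch.lean` (gen 8, crux write
20837567481b; farm rc 0) and of plan g85's kernel sheet `HOME/pub-ymgap-plan/D85-REV28/Sketch28.lean` ∕ `rev28/glue28.lean`, over the v1.8 VERSION SLOT of NODE 00's record
`Literature/…/Balaban1983to89/Node00/Record13SepCoPHV.lean` (p620607: `Node00.Revision₁₃ F N θ h` = a re-choice of the record's level-`k ≥ 1` densities inside their `dV`-a.e. classes, level 0
verbatim; `Node00.datumOfRecord₁₃SepCoPHV F N θ h v`; the door `Node00.datumOfRecord₁₃SepCoPHV_refl` is `rfl`; the faces `toB12_…` ∕ `βfun_…` ∕ `flow_…` are `rfl`).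
[I] = [Balaban1987RG1] Commun. Math. Phys. **109** (1987); [III] = [Balaban1988Convergent] Commun. Math. Phys. **119** (1988); [V] = [Balaban1989LargeFieldII] Commun. Math. Phys. **122** (1989).

WHY.  Rev 27's deciding crux K1⁸ (stmt-QuantumFields-26907) asked [V] Thm 1's (B) `B16.EndStatementBPrinted D.C` — whose Cor. 3 half ([III] (2.50) p.264) reads the densities POINTWISE — of the UNREVISED
record datum, and dag-n13-w1's kernel witness (p617654 `…K1R8VersionPinOnNullUnitFibre`) shows that pointwise letter can fail on a `dV`-null set while every a.e. statement of the N13 engines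
holds.  The (δⱽ) repair displays a VERSION SLOT: K1⁹ asks (B) AS PRINTED of SOME re-chosen datum `Node00.datumOfRecord₁₃SepCoPHV F 2 θ h v` (the slot `v` a LEADING binder of the witness tuple; the
window is read at the same datum and is version-free; the run rows (i)(iv)(C) are θ-level and byte-kept), K2⁹ ∕ K3⁸ carry the extra binder `v` and read (B) ∕ END ∕ the hybrid prefix at the slot.
THIS FILE gives every K lane the names: §1 the three item texts ≡ their by-name spelling over `K1V6Defs.Inhabited13` ∕ `K1V6Defs.Window` ∕ `K1R8RowsDefs.RunRowsCont13` (`Iff.rfl`); §2 the slot faces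
the texts read (`Window (datumⱽ) ↔ Window (datum)`, `Iff.rfl`; K1⁹ ↔ K1⁸'s display with ONLY the (B) conjunct replaced by the producers' letter `∃ v, (B)ⱽ`); §3 the doors (the ∀-`v` displays K2⁹ ∕ K3⁸
are the STRONGER ones, K1⁹ the WEAKER one); §4 per-tuple use forms: END at the slot from the rows (node n24's END theorem of record BY NAME through the `Iff.rfl` face), the K1⁹ constructor, and
«a K3 road proved at the record transfers to EVERY version» (dag-n17-w2 g6's located fact, pub-ymgap bus l.35318, at item level).  Successor key of record for suppliers of K1⁹: `--supports <K1⁹ item>`.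

CONTENTS (0 `def`; theorems only; 0 `sorry`; [folklore] bookkeeping; no `instance`, no `notation`, no `axiom`).

NOT IN THIS FILE (others' lanes, not restated): the K2⁹ support item's one-line CLOSER (a `--workitem` file, `…Theorems.BalabanUVNodesK2R9Holds` or the RUNBOOK owner's); the PRODUCERS of the
slot letter `∃ v : Node00.Revision₁₃ F 2 θ h, B16.EndStatementBPrinted (Node00.datumOfRecord₁₃SepCoPHV F 2 θ h v).C` (dag-n13-w2 p621421 `…N13Cor3AEKeepZeroOfEnginesRowAtRecord13` §4, dag-n13-w1's
route-free junction `…K1R9VersionSlotOfAEAtRecord` over p620313 `T4DatumAssemblyTowerReviseAE` + p620607's adapters); the K1 v8 ∕ K3 v6 skeletons (plan g85's, registered on the newborn items).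

HONEST FRAMING.  `Iff.rfl` ∕ binder bookkeeping over the items of record; NOTHING of Bałaban asserted; no stub proved; nothing registered or re-registered here; no density re-chosen, no a.e.
statement proved, no anchor ∕ drift ∕ remainder ∕ floor ∕ continuity ∕ endpoint shown to exist anywhere here; K0⁷ stmt-QuantumFields-20541 ∕ K1⁹ ∕ K3⁸ OPEN (K1⁸ 26907 ∕ K3⁷ 20544 ∕ K2⁸ 26908 →
`aside` at rev 28 with their decls, skeletons and supplier roads kept as history); (B)'s Cor-3 half, (D1) ∕ (D4) ∕ (C) NOT discharged; counts unmoved (typed 28∕28 · discharged 5∕27 (A 5∕28)).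
[I] Thm 2 + (0.31) p. 259 (NODE O) and [I] §1 pp. 263–264 (continuity of the coefficients) UNPROVED IN PRINT.  Route R4 closes the CONDITIONAL finite-𝕋⁴ rung `BalabanLadder.UV` only — ONE kernel
implication on ONE finite 𝕋⁴ at fixed ε; NOT continuum, NOT ℝ⁴, NOT OS, NOT a mass gap, NOT Clay; the Yang–Mills mass gap is NOT proved by any of this.  Sources (context only): [V] Thm 1 p. 355 +
(0.1) pp. 355–356; [III] (2.18) p. 257, Cor. 3 (2.50) p. 264; [I] Thm 2 p. 259, Thm 3 p. 264, (5.10) p. 293, §1 pp. 263–264.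
-/

open scoped Matrix.Norms.L2Operator

namespace Summit.QuantumFields.YangMills.Theorems.BalabanUVNodesK1R9VersionSlotDefs

open Literature.MathematicalPhysics.QuantumFieldTheory.Balaban1983to89
open Literature.MathematicalPhysics.QuantumFieldTheory.Balaban1983to89.FlowStep
open Literature.MathematicalPhysics.QuantumFieldTheory.Balaban1983to89.FlowStepRuns
open Literature.MathematicalPhysics.QuantumFieldTheory.Balaban1983to89.DagBinding
open Literature.MathematicalPhysics.QuantumFieldTheory.Balaban1983to89.T4Continuum (T4Family)
open Summit.QuantumFields.YangMills.Theorems.K1V6Defs (Inhabited13 Window)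
open Summit.QuantumFields.YangMills.Theorems.BalabanUVNodesK1R8RowsDefs (RunRowsCont13 endpointExistence_of_runRowsCont13)
open Summit.QuantumFields.YangMills.Theses.BalabanUVNodes
  (StabilityBRunRowsAtRecordR13SepCoPH EndpointGivenRunRowsR13SepCoPH SpineGivenEndpointR13SepCoPH
   StabilityBRunRowsAtRecordR13SepCoPHV EndpointGivenRunRowsR13SepCoPHV SpineGivenEndpointR13SepCoPHV)


/-! ## §1 The three rev-28 item texts BY NAME (`Iff.rfl` kernel certificates) -/

/-- **K1⁹ BY NAME** (kernel): the route decl `…Theses.BalabanUVNodes.StabilityBRunRowsAtRecordR13SepCoPHV` (crux, DECIDING at rev 28) is literally «`∀ F, Inhabited13 F → ∃ θ h (v : Node00.Revision₁₃ F 2 θ h),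
(unity ∧ slots) ∧ Admissible ∧ (B) AS PRINTED of the REVISED datum ∧ Window (revised datum) ∧ RunRowsCont13 F θ`» — K1⁸'s display with the version slot `v` leading the witness tuple (plan g85
`D85-REV28`, recipe (δⱽ)), `Iff.rfl`. [cite: Balaban1989LargeFieldII, Thm 1 p.355; Balaban1988Convergent, Cor. 3 (2.50) p.264; Balaban1987RG1, Thm 3 p.264, (5.10) p.293, §1 pp.263–264 (bookkeeping)] -/
theorem stabilityBRunRowsAtRecordR13SepCoPHV_iff :
    StabilityBRunRowsAtRecordR13SepCoPHV ↔
      ∀ F : T4Family, Inhabited13 F → ∃ (θ : Node00.Stage13HParams F 2) (h : θ.Provisos₁₃SepCoPH F 2) (v : Node00.Revision₁₃ F 2 θ h),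
        (θ.ZhUnity F 2 ∧ θ.SlotsNondegenerate₁₃ F 2) ∧ θ.Admissible F 2 ∧ B16.EndStatementBPrinted (Node00.datumOfRecord₁₃SepCoPHV F 2 θ h v).C ∧
        Window (Node00.datumOfRecord₁₃SepCoPHV F 2 θ h v) ∧ RunRowsCont13 F θ :=
  Iff.rfl

/-- **K2⁹ BY NAME** (kernel): the route decl `…Theses.BalabanUVNodes.EndpointGivenRunRowsR13SepCoPHV` (support, born to be closed by node n24's END theorem BY NAME) is literally «at every `(F, θ, h, v)`:
(unity ∧ slots) → Admissible → (B) of the revised datum → `RunRowsCont13 F θ` → Window (revised datum) → `EndpointExistence (revised datum).C.toB12`», `Iff.rfl`.  This file does NOT prove that decl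
(its closer is a `--workitem` file); the per-tuple use form is `endpointExistence_datumOfRecord₁₃SepCoPHV_of_runRowsCont13` (§4). [cite: Balaban1987RG1, Thm 2 p.259 (first sentence), Thm 3 p.264, (5.10) p.293 (bookkeeping)] -/
theorem endpointGivenRunRowsR13SepCoPHV_iff :
    EndpointGivenRunRowsR13SepCoPHV ↔
      ∀ (F : T4Family) (θ : Node00.Stage13HParams F 2) (h : θ.Provisos₁₃SepCoPH F 2) (v : Node00.Revision₁₃ F 2 θ h),
        (θ.ZhUnity F 2 ∧ θ.SlotsNondegenerate₁₃ F 2) → θ.Admissible F 2 → B16.EndStatementBPrinted (Node00.datumOfRecord₁₃SepCoPHV F 2 θ h v).C →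
        RunRowsCont13 F θ → Window (Node00.datumOfRecord₁₃SepCoPHV F 2 θ h v) → EndpointExistence (Node00.datumOfRecord₁₃SepCoPHV F 2 θ h v).C.toB12 :=
  Iff.rfl

/-- **K3⁸ BY NAME, ITS BODY AT THE RECORD** (kernel): the route decl `…Theses.BalabanUVNodes.SpineGivenEndpointR13SepCoPHV` is literally «at every `(F, θ, h, v)`: (unity ∧ slots) → Admissible → (B) of the
REVISED datum → END → the hybrid-NE7 spine under the prefix», and — END, `Tuned`, `scheme` being version-free (`Node00.toB12_…` ∕ `tuned_…_iff` ∕ `scheme_…`, all `rfl`) — that spine unfolds to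
«(B)ⱽ → END (record) → the record's tuned-window body over the record's Wilson schemes» (`Node00.hybridNE7Under_datumOfRecord₁₃SepCoPHV_iff`): ONLY the (B) antecedent reads the slot. `Iff.rfl`.
[cite: Balaban1989LargeFieldII, (0.1) p.356; Balaban1987RG1, Thm 2 p.259 (bookkeeping)] -/
theorem spineGivenEndpointR13SepCoPHV_iff :
    SpineGivenEndpointR13SepCoPHV ↔
      ∀ (F : T4Family) (θ : Node00.Stage13HParams F 2) (h : θ.Provisos₁₃SepCoPH F 2) (v : Node00.Revision₁₃ F 2 θ h),
        (θ.ZhUnity F 2 ∧ θ.SlotsNondegenerate₁₃ F 2) → θ.Admissible F 2 → B16.EndStatementBPrinted (Node00.datumOfRecord₁₃SepCoPHV F 2 θ h v).C →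
        EndpointExistence (Node00.datumOfRecord₁₃SepCoPH F 2 θ h).C.toB12 →
          (B16.EndStatementBPrinted (Node00.datumOfRecord₁₃SepCoPHV F 2 θ h v).C → EndpointExistence (Node00.datumOfRecord₁₃SepCoPH F 2 θ h).C.toB12 →
            ∃ γ₀ : ℝ, 0 < γ₀ ∧ ∀ γ : ℝ, 0 < γ → γ ≤ γ₀ → ∃ g₁ : ℝ, 0 < g₁ ∧ ∀ g : ℝ, 0 < g → g ≤ g₁ →
              ∀ g₀ : ℕ → ℝ, (Node00.datumOfRecord₁₃SepCoPH F 2 θ h).Tuned γ g g₀ →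
                T4ApexHybrid.StringwiseHybridNE7 ((Node00.datumOfRecord₁₃SepCoPH F 2 θ h).scheme g₀)) :=
  Iff.rfl

/-! ## §2 The slot faces the texts read -/

/-- **THE WINDOW IS VERSION-FREE** (`Iff.rfl`): `K1V6Defs.Window` reads `(D.C P).flow` only and `Node00.flow_datumOfRecord₁₃SepCoPHV` is `rfl` — so K1⁹'s ∕ K2⁹'s window clause at the revised datum IS
the record's window clause. [cite: Balaban1987RG1, (0.17)–(0.20) pp.255–256 (bookkeeping)] -/
theorem window_datumOfRecord₁₃SepCoPHV_iff {F : T4Family} (θ : Node00.Stage13HParams F 2) (h : θ.Provisos₁₃SepCoPH F 2) (v : Node00.Revision₁₃ F 2 θ h) :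
    Window (Node00.datumOfRecord₁₃SepCoPHV F 2 θ h v) ↔ Window (Node00.datumOfRecord₁₃SepCoPH F 2 θ h) :=
  Iff.rfl

/-- **K1⁹ ≡ K1⁸'s DISPLAY WITH ONLY THE (B) CONJUNCT RE-KEYED TO THE PRODUCERS' LETTER** `∃ v : Node00.Revision₁₃ F 2 θ h, B16.EndStatementBPrinted (Node00.datumOfRecord₁₃SepCoPHV F 2 θ h v).C`
(the conclusion shape of dag-n13-w2's p621421 §4 ∕ dag-n13-w1's route-free junction ∕ p620607's adapter `exists_revision₁₃_endStatementBPrinted_of_exists_update`), the window and the rows read AT THE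
RECORD: binder bookkeeping (the window transfers by `window_datumOfRecord₁₃SepCoPHV_iff`).  So a LINE-2 supplier owes K1⁸'s parts minus (B), plus that one letter, at one witness.
[cite: Balaban1989LargeFieldII, Thm 1 p.355; Balaban1988Convergent, (2.18) p.257, Cor. 3 (2.50) p.264 (bookkeeping)] -/
theorem stabilityBRunRowsAtRecordR13SepCoPHV_iff_existsSlot :
    StabilityBRunRowsAtRecordR13SepCoPHV ↔
      ∀ F : T4Family, Inhabited13 F → ∃ (θ : Node00.Stage13HParams F 2) (h : θ.Provisos₁₃SepCoPH F 2),
        (θ.ZhUnity F 2 ∧ θ.SlotsNondegenerate₁₃ F 2) ∧ θ.Admissible F 2 ∧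
        (∃ v : Node00.Revision₁₃ F 2 θ h, B16.EndStatementBPrinted (Node00.datumOfRecord₁₃SepCoPHV F 2 θ h v).C) ∧
        Window (Node00.datumOfRecord₁₃SepCoPH F 2 θ h) ∧ RunRowsCont13 F θ := by
  constructor
  · intro h1 F hF
    obtain ⟨θ, h, v, hU, hθ, hb, hwin, hrows⟩ := h1 F hF
    exact ⟨θ, h, hU, hθ, ⟨v, hb⟩, hwin, hrows⟩
  · intro h1 F hF
    obtain ⟨θ, h, hU, hθ, ⟨v, hb⟩, hwin, hrows⟩ := h1 F hF
    exact ⟨θ, h, v, hU, hθ, hb, hwin, hrows⟩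

/-! ## §3 Doors between the rev-27 and rev-28 displays -/

/-- **DOOR K1⁸ ⟹ K1⁹** (`v := Node00.Revision₁₃.refl F 2 θ h`; `Node00.datumOfRecord₁₃SepCoPHV_refl` is `rfl`): the rev-28 crux is the WEAKER display — every proof of the aside decl K1⁸
`…StabilityBRunRowsAtRecordR13SepCoPH` (stmt-QuantumFields-26907) closes it verbatim (= the step of plan g85's K1 v8 composition `k1R9_of_stubs`, BY NAME).  CONDITIONAL; nothing closed.
[cite: Balaban1989LargeFieldII, Thm 1 p.355 (bookkeeping)] -/
theorem stabilityBRunRowsAtRecordR13SepCoPHV_of_k1R8 (h1 : StabilityBRunRowsAtRecordR13SepCoPH) : StabilityBRunRowsAtRecordR13SepCoPHV := by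
  intro F hF
  obtain ⟨θ, h, hU, hθ, hb, hwin, hrows⟩ := h1 F hF
  exact ⟨θ, h, Node00.Revision₁₃.refl F 2 θ h, hU, hθ, hb, hwin, hrows⟩

/-- **DOOR K2⁹ ⟹ K2⁸** (instantiate `v := .refl`): the ∀-`v` display is the STRONGER one. CONDITIONAL. [cite: Balaban1987RG1, Thm 2 p.259 (bookkeeping)] -/
theorem endpointGivenRunRowsR13SepCoPH_of_k2R9 (h2 : EndpointGivenRunRowsR13SepCoPHV) : EndpointGivenRunRowsR13SepCoPH :=
  fun F θ h hU hθ hb hrows hwin => h2 F θ h (Node00.Revision₁₃.refl F 2 θ h) hU hθ hb hrows hwin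

/-- **DOOR K3⁸ ⟹ K3⁷** (instantiate `v := .refl`): the ∀-`v` display is the STRONGER one — the aside decl K3⁷ `…SpineGivenEndpointR13SepCoPH` (stmt-QuantumFields-20544) follows. CONDITIONAL.
[cite: Balaban1989LargeFieldII, (0.1) p.356 (bookkeeping)] -/
theorem spineGivenEndpointR13SepCoPH_of_k3R8 (h3 : SpineGivenEndpointR13SepCoPHV) : SpineGivenEndpointR13SepCoPH :=
  fun F θ h hU hθ hb hend => h3 F θ h (Node00.Revision₁₃.refl F 2 θ h) hU hθ hb hend

/-! ## §4 Per-tuple use forms at the slot -/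

/-- **END AT THE REVISED DATUM FROM THE RUN ROWS** (every version `v`): `RunRowsCont13 F θ` ⟹ `EndpointExistence (Node00.datumOfRecord₁₃SepCoPHV F 2 θ h v).C.toB12` — node n24's END theorem of record
BY NAME (`K1R8RowsDefs.endpointExistence_of_runRowsCont13` = dag-n13-w4's `…K1WindowKOfRunRowsSurvivors.endpointExistence_datumOfRecord₁₃SepCoPH_of_runRows_survCont`) through the `Iff.rfl` face
`Node00.endpointExistence_datumOfRecord₁₃SepCoPHV_iff`; unity, admissibility, (B), the window UNUSED.  = K2⁹'s text per tuple; CONDITIONAL on the rows; NOT the K2⁹ item decl.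
[cite: Balaban1987RG1, Thm 2 p.259 (first sentence), Thm 3 p.264, (5.10) p.293, §1 pp.263–264] -/
theorem endpointExistence_datumOfRecord₁₃SepCoPHV_of_runRowsCont13 {F : T4Family} (θ : Node00.Stage13HParams F 2) (h : θ.Provisos₁₃SepCoPH F 2)
    (v : Node00.Revision₁₃ F 2 θ h) (hrows : RunRowsCont13 F θ) :
    EndpointExistence (Node00.datumOfRecord₁₃SepCoPHV F 2 θ h v).C.toB12 :=
  (Node00.endpointExistence_datumOfRecord₁₃SepCoPHV_iff F 2 θ h v).mpr (endpointExistence_of_runRowsCont13 θ h hrows)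

/-- **CONSTRUCTOR OF K1⁹'s CONSEQUENT AT ONE WITNESS `(θ, h, v)`**: unity ∧ slots, admissibility, (B) of the revised datum, the window (record currency) and the rows ⟹ K1⁹'s ∃-tuple at `F`.
[cite: Balaban1989LargeFieldII, Thm 1 p.355 (bookkeeping)] -/
theorem stabilityBRunRowsAtRecordR13SepCoPHV_intro {F : T4Family} (θ : Node00.Stage13HParams F 2) (h : θ.Provisos₁₃SepCoPH F 2) (v : Node00.Revision₁₃ F 2 θ h)
    (hU : θ.ZhUnity F 2 ∧ θ.SlotsNondegenerate₁₃ F 2) (hθ : θ.Admissible F 2) (hb : B16.EndStatementBPrinted (Node00.datumOfRecord₁₃SepCoPHV F 2 θ h v).C)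
    (hwin : Window (Node00.datumOfRecord₁₃SepCoPH F 2 θ h)) (hrows : RunRowsCont13 F θ) :
    ∃ (θ : Node00.Stage13HParams F 2) (h : θ.Provisos₁₃SepCoPH F 2) (v : Node00.Revision₁₃ F 2 θ h),
      (θ.ZhUnity F 2 ∧ θ.SlotsNondegenerate₁₃ F 2) ∧ θ.Admissible F 2 ∧ B16.EndStatementBPrinted (Node00.datumOfRecord₁₃SepCoPHV F 2 θ h v).C ∧
      Window (Node00.datumOfRecord₁₃SepCoPHV F 2 θ h v) ∧ RunRowsCont13 F θ :=
  ⟨θ, h, v, hU, hθ, hb, hwin, hrows⟩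

/-- **A K3 ROAD THAT READS (B) AT THE SLOT AND EVERYTHING ELSE AT THE RECORD GIVES K3⁸**: per admissible unity tuple and version, «(B)ⱽ → END (record) → the record's tuned-window body» ⟹ the item,
through `Node00.hybridNE7Under_datumOfRecord₁₃SepCoPHV_iff` and `Node00.endpointExistence_datumOfRecord₁₃SepCoPHV_iff` (both `Iff.rfl`).  CONDITIONAL on the displayed road; K3⁸ NOT closed.
[cite: Balaban1989LargeFieldII, (0.1) p.356; Balaban1987RG1, Thm 2 p.259 (bookkeeping)] -/
theorem spineGivenEndpointR13SepCoPHV_of_bodyAtRecord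
    (hK3 : ∀ (F : T4Family) (θ : Node00.Stage13HParams F 2) (h : θ.Provisos₁₃SepCoPH F 2) (v : Node00.Revision₁₃ F 2 θ h),
      (θ.ZhUnity F 2 ∧ θ.SlotsNondegenerate₁₃ F 2) → θ.Admissible F 2 → B16.EndStatementBPrinted (Node00.datumOfRecord₁₃SepCoPHV F 2 θ h v).C →
      EndpointExistence (Node00.datumOfRecord₁₃SepCoPH F 2 θ h).C.toB12 →
        ∃ γ₀ : ℝ, 0 < γ₀ ∧ ∀ γ : ℝ, 0 < γ → γ ≤ γ₀ → ∃ g₁ : ℝ, 0 < g₁ ∧ ∀ g : ℝ, 0 < g → g ≤ g₁ →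
          ∀ g₀ : ℕ → ℝ, (Node00.datumOfRecord₁₃SepCoPH F 2 θ h).Tuned γ g g₀ →
            T4ApexHybrid.StringwiseHybridNE7 ((Node00.datumOfRecord₁₃SepCoPH F 2 θ h).scheme g₀)) :
    SpineGivenEndpointR13SepCoPHV :=
  fun F θ h v hU hθ _ _ hb hend => hK3 F θ h v hU hθ hb hend

/-- **… IN PARTICULAR A (B)-FREE K3 ROAD AT THE RECORD TRANSFERS TO EVERY VERSION VERBATIM** (dag-n17-w2 g6's located fact for the v5 prefix-keyed faces, at item level): «unity → Admissible → END (record)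
→ the record's body» at every admissible tuple ⟹ K3⁸ (the (B)ⱽ antecedent unused).  CONDITIONAL; K3⁸ NOT closed. [cite: Balaban1989LargeFieldII, (0.1) p.356 (bookkeeping)] -/
theorem spineGivenEndpointR13SepCoPHV_of_bFreeAtRecord
    (hK3 : ∀ (F : T4Family) (θ : Node00.Stage13HParams F 2) (h : θ.Provisos₁₃SepCoPH F 2),
      (θ.ZhUnity F 2 ∧ θ.SlotsNondegenerate₁₃ F 2) → θ.Admissible F 2 → EndpointExistence (Node00.datumOfRecord₁₃SepCoPH F 2 θ h).C.toB12 →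
        ∃ γ₀ : ℝ, 0 < γ₀ ∧ ∀ γ : ℝ, 0 < γ → γ ≤ γ₀ → ∃ g₁ : ℝ, 0 < g₁ ∧ ∀ g : ℝ, 0 < g → g ≤ g₁ →
          ∀ g₀ : ℕ → ℝ, (Node00.datumOfRecord₁₃SepCoPH F 2 θ h).Tuned γ g g₀ →
            T4ApexHybrid.StringwiseHybridNE7 ((Node00.datumOfRecord₁₃SepCoPH F 2 θ h).scheme g₀)) :
    SpineGivenEndpointR13SepCoPHV :=
  spineGivenEndpointR13SepCoPHV_of_bodyAtRecord fun F θ h _ hU hθ _ hend => hK3 F θ h hU hθ hend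

/-- **K1⁹'s WITNESS GIVES END AT ITS OWN SLOT** (the `closes` step K1⁹ → K2⁹ per `F`, by name): from K1⁹'s ∃-tuple at `F`, END of the revised datum at that witness — so the rung's `∃ D` is presented at
`Node00.datumOfRecord₁₃SepCoPHV F 2 θ h v` with its Stage-0 clause `Node00.isDatumOfRecord₀_datumOfRecord₁₃SepCoPHV` (`rfl`).  CONDITIONAL on K1⁹; sanity form of the deciding theorem's middle step.
[cite: Balaban1989LargeFieldII, Thm 1 + (0.1) pp.355–356; Balaban1987RG1, Thm 2 p.259 (bookkeeping)] -/
theorem exists_slot_endpointExistence_of_k1R9 (h1 : StabilityBRunRowsAtRecordR13SepCoPHV) (F : T4Family) (hF : Inhabited13 F) :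
    ∃ (θ : Node00.Stage13HParams F 2) (h : θ.Provisos₁₃SepCoPH F 2) (v : Node00.Revision₁₃ F 2 θ h),
      (θ.ZhUnity F 2 ∧ θ.SlotsNondegenerate₁₃ F 2) ∧ θ.Admissible F 2 ∧ B16.EndStatementBPrinted (Node00.datumOfRecord₁₃SepCoPHV F 2 θ h v).C ∧
      Node00.IsDatumOfRecord₀ F 2 (Node00.datumOfRecord₁₃SepCoPHV F 2 θ h v) ∧ EndpointExistence (Node00.datumOfRecord₁₃SepCoPHV F 2 θ h v).C.toB12 := by
  obtain ⟨θ, h, v, hU, hθ, hb, -, hrows⟩ := h1 F hF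
  exact ⟨θ, h, v, hU, hθ, hb, Node00.isDatumOfRecord₀_datumOfRecord₁₃SepCoPHV F 2 θ h v, endpointExistence_datumOfRecord₁₃SepCoPHV_of_runRowsCont13 θ h v hrows⟩

end Summit.QuantumFields.YangMills.Theorems.BalabanUVNodesK1R9VersionSlotDefs
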